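import Mathlib
import HarnessLib
import HarnessLib.Audit.Tags

/-!
# HodgeLocusCensusSliceDimension — the dimension bookkeeping behind a FAT-POINT row
('Prop. A (b = 1)': an Artinian slice by `r` functions bounds the germ dimension by `r`; a contained
germ of dimension `r` is then an irreducible component)

HONEST FRAMING (verbatim, pub-hlocus cell): certified instances and evidence bearing on the general
Hodge conjecture; no claim.

DICTIONARY (cell files `CENSUS-SUMMARY.md` §2 row O8 clause (a), `data/ivhs/census/og81/O-g9.md`).
`R = 𝒪_{V_λ, X_F}` is the (Noetherian, local) ring of the Hodge-locus germ at the Fermat point;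
the slice `X_F + Λ` is cut out of the ambient affine chart by `r = N − dim Λ` linear forms, whose images
`s ⊆ 𝔪_R` (`|s| = r`) present the slice germ `V_λ ∩ (X_F + Λ)` as `R ⧸ (s)`; `Λ` is a linear complement of
`T_{X_F} NL(pair)`, so `r = dim NL(pair)` (`= 100` in the (8,3,1) census).  A FAT-POINT row says
`R ⧸ (s)` is Artinian (a finite, two-kernel computation of the cell, NOT formalised).  The algebraic
set `NL(pair) ∋ X_F` is contained in `V_λ` and is smooth of dimension `r` there (cited Noether–Lefschetz
theory + a rank computation, NOT formalised); on rings: a prime `P` of `R` with `dim R ⧸ P = r`.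

What the kernel checks (pure commutative algebra, Mathlib's Krull height theorem):
* `ringKrullDim_le_card_of_isArtinianRing_quotient` — PROP. A core: `R ⧸ (s)` Artinian, `s ⊆ 𝔪`
  finite ⇒ `dim R ≤ |s|`: every component of `V_λ` through `X_F` has dimension `≤ r = dim NL(pair)`.
* `ringKrullDim_eq_card_of_quotient_prime` — with a prime `P`, `dim R ⧸ P = |s|`: `dim R = |s|`.
* `mem_minimalPrimes_of_ringKrullDim_quotient_eq` — in any commutative ring of finite dimension `n`, a
  prime `P` with `dim R ⧸ P = n` is a MINIMAL prime: `NL(pair)` is an irreducible component of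
  `(V_λ)_red` through `X_F`.
* `fatPointRow_component` — the three assembled: Artinian slice by `s ⊆ 𝔪` + a prime `P` with
  `dim R ⧸ P = |s|` ⇒ `dim R = |s|` and `P` minimal.
NOT formalised: that the slice length `> 1` makes `V_λ ≠ NL(pair)` scheme-theoretically at `X_F`
(transversality of `Λ`; recorded in the census as the length itself), the identification of the other
components through `X_F` (the 'explained-type components' of row O8), and every Hodge-theoretic input.
No definitions are introduced.
-/

namespace Summit.HodgeConjecture.HodgeConjecture.HodgeLocus.Census

open IsLocalRing Order

section PropA

variable {R : Type*} [CommRing R]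

/-- **Prop. A (b = 1), algebraic core.**  In a Noetherian local ring, if the quotient by finitely many
elements `s` of the maximal ideal is Artinian (the slice germ is a fat point), then `dim R ≤ |s|`
(Krull's height theorem, Mathlib `ringKrullDim_le_ringKrullDim_quotient_add_card`). -/
theorem ringKrullDim_le_card_of_isArtinianRing_quotient [IsNoetherianRing R] [IsLocalRing R]
    (s : Finset R) (hs : (s : Set R) ⊆ (maximalIdeal R : Set R))
    [IsArtinianRing (R ⧸ Ideal.span (s : Set R))] : ringKrullDim R ≤ s.card := by
  have hj : (s : Set R) ⊆ (Ring.jacobson R : Set R) := by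
    rwa [IsLocalRing.ringJacobson_eq_maximalIdeal]
  have h := ringKrullDim_le_ringKrullDim_quotient_add_card s hj
  have hne : Ideal.span (s : Set R) ≠ ⊤ := by
    intro htop
    have : Ideal.span (s : Set R) ≤ maximalIdeal R := Ideal.span_le.mpr hs
    rw [htop, top_le_iff] at this
    exact (maximalIdeal.isMaximal R).ne_top this
  haveI : Nontrivial (R ⧸ Ideal.span (s : Set R)) := Ideal.Quotient.nontrivial_iff.mpr hne
  have h0 : ringKrullDim (R ⧸ Ideal.span (s : Set R)) = 0 :=
    ringKrullDimZero_iff_ringKrullDim_eq_zero.mp inferInstance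
  simpa [h0] using h

/-- … and if the germ contains an (integral) sub-germ of dimension `|s|` — a prime `P` with
`dim R ⧸ P = |s|` — then `dim R = |s|` exactly. -/
theorem ringKrullDim_eq_card_of_quotient_prime [IsNoetherianRing R] [IsLocalRing R]
    (s : Finset R) (hs : (s : Set R) ⊆ (maximalIdeal R : Set R))
    [IsArtinianRing (R ⧸ Ideal.span (s : Set R))] (P : Ideal R)
    (hP : ringKrullDim (R ⧸ P) = s.card) : ringKrullDim R = s.card :=
  le_antisymm (ringKrullDim_le_card_of_isArtinianRing_quotient s hs)
    (hP ▸ ringKrullDim_quotient_le P)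

end PropA

section Component

variable {R : Type*} [CommRing R]

/-- In a commutative ring of finite Krull dimension `n`, a prime `P` with `dim R ⧸ P = n` is a minimal
prime (height + coheight ≤ dimension).  Census reading: `NL(pair)` (dimension `r = dim_{X_F} V_λ`) is an
irreducible component of `V_λ` through `X_F`. -/
theorem mem_minimalPrimes_of_ringKrullDim_quotient_eq {n : ℕ} (hR : ringKrullDim R = n)
    (P : Ideal R) [hP : P.IsPrime] (hPn : ringKrullDim (R ⧸ P) = n) : P ∈ minimalPrimes R := by
  let a : PrimeSpectrum R := ⟨P, hP⟩
  haveI : Nonempty (PrimeSpectrum R) := ⟨a⟩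
  -- coheight a = dim (R ⧸ P)
  have hco : (coheight a : WithBot ℕ∞) = ringKrullDim (R ⧸ P) := by
    rw [coheight_eq_krullDim_Ici, ringKrullDim_quotient]
    refine Order.krullDim_eq_of_orderIso (OrderIso.setCongr _ _ ?_)
    ext q
    simp only [Set.mem_Ici, PrimeSpectrum.mem_zeroLocus, SetLike.coe_subset_coe]
    exact (PrimeSpectrum.asIdeal_le_asIdeal a q).symm
  rw [hPn] at hco
  have hco' : coheight a = n := by exact_mod_cast hco
  -- height a + coheight a ≤ krullDim = n
  have hsum : ((height a + coheight a : ℕ∞) : WithBot ℕ∞) ≤ krullDim (PrimeSpectrum R) := by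
    rw [krullDim_eq_iSup_height_add_coheight_of_nonempty]
    exact_mod_cast le_iSup (fun b : PrimeSpectrum R => height b + coheight b) a
  have hdim : krullDim (PrimeSpectrum R) = n := hR
  rw [hdim] at hsum
  have hsum' : height a + coheight a ≤ n := by exact_mod_cast hsum
  rw [hco'] at hsum'
  have hh : height a ≤ 0 := by
    have : height a + (n : ℕ∞) ≤ 0 + n := by simpa using hsum'
    exact (ENat.add_le_add_iff_right (ENat.coe_ne_top n)).mp this
  have hzero : P.height = 0 := by
    have := PrimeSpectrum.height_eq_orderHeight a
    simp only [a] at this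
    rw [this]
    exact nonpos_iff_eq_zero.mp hh
  exact Ideal.height_eq_zero_iff.mp hzero

/-- **Assembled census statement for a fat-point row.**  `R` Noetherian local (the germ of `V_λ` at
`X_F`), `s ⊆ 𝔪` with `R ⧸ (s)` Artinian (FAT-POINT slice), `P` a prime with `dim R ⧸ P = |s|`
(`NL(pair) ⊆ V_λ`, of dimension `|s| = dim NL(pair)` by the choice of `Λ`).  Then `dim R = |s|`
(every component of `V_λ` through `X_F` has dimension `≤ dim NL(pair)`, with equality attained) and `P`
is a minimal prime (`NL(pair)` is an irreducible component of `V_λ` at `X_F`). -/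
theorem fatPointRow_component [IsNoetherianRing R] [IsLocalRing R]
    (s : Finset R) (hs : (s : Set R) ⊆ (maximalIdeal R : Set R))
    [IsArtinianRing (R ⧸ Ideal.span (s : Set R))] (P : Ideal R) [P.IsPrime]
    (hP : ringKrullDim (R ⧸ P) = s.card) :
    ringKrullDim R = s.card ∧ P ∈ minimalPrimes R :=
  have hR := ringKrullDim_eq_card_of_quotient_prime s hs P hP
  ⟨hR, mem_minimalPrimes_of_ringKrullDim_quotient_eq hR P hP⟩

end Component

end Summit.HodgeConjecture.HodgeConjecture.HodgeLocus.Census
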